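import Summits.CriticalPhenomena.PercolationContinuityZ3.Theorems.Transplant.SkelPhiRootInputsG5Y
import Summits.CriticalPhenomena.PercolationContinuityZ3.Theorems.Transplant.SkelPhiRootLegY
import Summits.CriticalPhenomena.PercolationContinuityZ3.Theorems.Transplant.SkelNegBParamsFoot
import Summits.CriticalPhenomena.PercolationContinuityZ3.Theorems.Transplant.SkelPhiRootNumbersX
import HarnessLib

/-!
# N1 (the `{±1}` node), (R) column (NEG-SCOPE B.17, y′-family v3): **THE ROOT RESIDUE AT A VERTICAL DIRECTION FROM THE INPUTS AND NUMBERS, THREE LEGS** —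
# `Skelφ.rootOblTWAt_of_numbers6_y`: `rootOblTWAt_of_inputsG5_y` (hop → bridge → x-run prefix `xRunSched … q_X N_x` at `c_X` → y′-run `yRunSched … q_Y N_y` at `c_Y`) with the
# footprint tests instantiated as FINE footprint boxes and every ROOM discharged: legs 1–2 exactly as the x-family's `rootOblTWAt_of_numbers6_x` (near-root readings by the two
# lattice functionals (L-R2′), x-clearance off the REGIONS (L-R3), cross link bridge core `1` → x-core `0`, nonempty x-cores), WITHOUT the x-run's target box; leg 3 by
# `legY_roomsR` (regions' footprints READ ONE BY ONE — hp-8 g33's located over-read of a drifting run's prism hull —, x-clearance of every y′-region off `InRegion`'s transverse bounds, nonempty y′-cores, cross link x-core `N_x + 1` → y′-core `0` in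
# root-frame coordinates, last y′-core in the target box).  What remains: the Step-I″ inputs at every centre, the hop, the seed facts, the excess radius, and NUMERIC
# hypotheses (integer inequalities / box inclusions on the fine-cell constants, the bridge frame, `y_X`, `y_Y`, `q_X`, `q_Y`, the kit constants) — for stmt-g14.

WHY three legs (located (L-R4), lane INBOX 2026-08-21T19:47Z): started next to the seed, the y′-run's first link regions contain the root; the x-prefix moves the chain
`≈ (N_x + 1)·n_L` sideways first; with hop side `σ := σ′·sgn⁺(v_L)` every y′-region is then x-clear of the pinned seed (hypothesis `hclrY`).

builds on p205010 (kernel theorem, internal audit signed; external expert review pending) — nothing in this file uses p205010; nothing here is a claim about the open node.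
Lane `prim-bschramm`, seat `prim-bschramm-p3` (gen 10; design owner + (R) owner); helper file (`--supports stmt-CriticalPhenomena-4575 --as helper`).
[cite: KozmaNitzan2024, §4 p. 28 ((32) at the root), Lemma 11 (pp. 22–23), Lemma 12 (pp. 23–25)] [cite: MartineauTassion2017, §3.2 (pieces), §4.3 Lemma 4.2]
-/

noncomputable section

open MeasureTheory ProbabilityTheory
open scoped ENNReal Classical

namespace Summit.CriticalPhenomena.PercolationContinuityZ3.Theorems

namespace Transplant

namespace Skelφ

open Literature.Probability.Percolation Literature.Probability.LatticeModels SimpleGraph GadgetSystem ProbeHistory HSiteScheme Contour KNCells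
open Literature.Probability.Percolation.KozmaNitzan.Cells (oth sgOf sgOf_sign stepVec_apply_fst)
open KNCells.KSchA KNLevels ChainPlanar ChainPara
open Literature.Barriers.CriticalPhenomena (graphBall mem_graphBall_self graphBall_mono)
open BoxProdZ2 (ConcRadiiG)
open Skel (winGraph RootOblTWAt excess)
open SkelI (tanOff)
open TwoAxis.Para (modulus)

variable {V : Type} [DecidableEq V] [Countable V] {G : SimpleGraph V} [G.LocallyFinite] {φ : V → Site 2}

/-! ## The root residue at a vertical direction from the inputs and numbers, three legs -/

/-- **THE ROOT RESIDUE AT A VERTICAL DIRECTION FROM THE INPUTS AND NUMBERS, THREE LEGS** (see the module docstring). Footprint tests `FootBox flo fhi fw du (fineSkel … w)` (root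
world) / `FootBox glo ghi gw du (fineSkel … w)` (target box); run origins `cX`, `cY` with `φ cX = φ t + yX`, `φ cY = φ t + yY` (exist by `exists_mem_graphBall_φ_eq`).
[cite: KozmaNitzan2024, §4 p. 28 ((32) at the root), Lemma 11 (pp. 22–23), Lemma 12 (pp. 23–25)] -/
theorem rootOblTWAt_of_numbers6_y {types : Finset V} (hlipφ : Lip G φ) (hstep : Steps G φ) (hfr : Frames G φ types) (hκ : CylConn G φ types)
    {Δg : ℕ} (hΔg : ∀ v, G.degree v ≤ Δg)
    -- the scheme, its root, the direction
    (S : KSchA V ℕ) {t : V} (hroot : S.Γ.root = t) (du : MDir) {σ : ℤ} (hσ : σ = 1 ∨ σ = -1) {Rπ : ℕ}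
    -- the fine map and the two footprint boxes, read into the scheme
    {Af vα vβ c0f c1f Df : ℤ} (hAf : 0 ≤ Af) {nL : ℕ} (hnL : 1 ≤ nL) (hL : ℤ) (hmf : 0 ≤ modulus nL hL vα vβ) (hc0 : 0 ≤ c0f) (hc1 : 0 ≤ c1f) (hDf : 0 < Df)
    {flo fhi fw glo ghi gw : ℤ}
    (hUfoot : ∀ w ∈ graphBall G t Rπ, FootBox flo fhi fw du (fineSkel φ t Af nL hL vα vβ c0f c1f (Df / 2) (Df / 2) Df w) → w ∈ S.U0root du)
    (hMfoot : ∀ w ∈ graphBall G t Rπ, FootBox glo ghi gw du (fineSkel φ t Af nL hL vα vβ c0f c1f (Df / 2) (Df / 2) Df w) →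
      w ∈ S.Γ.M S.Γ.a₀ ((0 : Site 2) + stepVec du))
    -- the pinned seed
    {A : Finset V} (htA : t ∈ A) (hAconn : ∀ a ∈ A, PathIn G (↑A : Set V) t a) {ρ : ℕ} (hAρ : ∀ a ∈ A, a ∈ graphBall G t ρ) (hρπ : ρ ≤ Rπ)
    (hAQ : A ⊆ S.Γ.Q S.Γ.a₀ 0) {kb : ℕ} (hAφ : ∀ a ∈ A, |φ a 0 - φ t 0| ≤ kb)
    -- the bridge frame, the long run (x-run schedule in the x-frame at a vertex `cX` with `φ cX = φ t + yX`), level data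
    (B : BridgePrm) (hB : BridgeOK B) {kq : ℕ} (hκL : hL.natAbs ≤ kq * nL) (ℓ' R's qX Nx Rl : ℕ) {yX : Site 2} (cX : V) (hcX : φ cX = φ t + yX)
    {RcX : ℕ} (hcXπ : cX ∈ graphBall G t RcX)
    -- the y′-run (third leg): split value `vL`, layer inequality, origin `cY` with `φ cY = φ t + yY`, vertical sign `σ'`
    {vL : ℤ} (hvL : |vL| ≤ nL) (hlay : (nL + hL.natAbs : ℕ) ≤ (nL : ℤ) * ℓ' + 1) (qY Ny : ℕ) {yY : Site 2} (cY : V) (hcY : φ cY = φ t + yY)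
    {RcY : ℕ} (hcYπ : cY ∈ graphBall G t RcY) {σ' : ℤ} (hσ' : σ' = 1 ∨ σ' = -1)
    (Rlev₁ N₁ j₀₁ j₁₁ Rlev₂ N₂ j₀₂ j₁₂ Rlev₃ N₃ j₀₃ j₁₃ : ℕ) (hRl₁ : Rlev₁ + 1 ≤ B.R') (hRl₂ : Rlev₂ + 1 ≤ R's) (hRl₃ : Rlev₃ + 1 ≤ R's)
    (hj₁ : j₁₁ ≤ Rlev₁) (hj₂ : j₁₂ ≤ Rlev₂) (hj₃ : j₁₃ ≤ Rlev₃)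
    -- ROOM NUMBERS (a): the hop's landing box inside core `0` of the bridge; the long prism radius inside the window
    (hB0 : Finset.Icc (pt nL (σ * hL)) (pt nL (σ * hL + ℓ')) ⊆ Finset.Icc B.B₀lo B.B₀hi) (hRlπ : Rl ≤ Rπ)
    -- ROOM NUMBERS (b): near-root reach of the bridge region and of the hop prism, READ BY THE TWO LATTICE FUNCTIONALS `Λ₀ = |vβΔ₀ − vαΔ₁|`, `Λ₁ = |nΔ₁ − hΔ₀|` (L-R2′)
    {Λ₀ Λ₁ kR₀ kR₁ : ℤ} (hΛR : ∀ x ∈ Finset.Icc B.regionLo B.regionHi, |vβ * (σ * x 0) - vα * x 1| ≤ Λ₀ ∧ |(nL : ℤ) * x 1 - hL * (σ * x 0)| ≤ Λ₁)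
    (hvα : |vα| ≤ nL) (hΛQ0 : modulus nL hL vα vβ + (nL : ℤ) * ((3 * ℓ' : ℕ) : ℤ) ≤ Λ₀) (hΛQ1 : (nL : ℤ) * ((3 * ℓ' : ℕ) : ℤ) ≤ Λ₁)
    (hkR0 : c0f * (|Af| * Λ₀) ≤ kR₀ * Df) (hkR1 : c1f * (|Af| * Λ₁) ≤ kR₁ * Df)
    (hfR0 : du.1 = 0 → flo ≤ -kR₀ ∧ kR₀ ≤ fhi ∧ kR₁ ≤ fw) (hfR1 : du.1 = 1 → flo ≤ -kR₁ ∧ kR₁ ≤ fhi ∧ kR₀ ≤ fw)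
    -- ROOM NUMBERS (c): the x-prefix's prism as a box of the x-frame and its reading into the root-world box (sign-unified)
    {paLo pbLo paHi pbHi : ℤ} (hprism : (xRunSched nL ℓ' hL R's qX Nx).prism ⊆ Finset.Icc (pt paLo pbLo) (pt paHi pbHi)) {PLO PHI : Site 2}
    (hP0 : PLO 0 ≤ TwoAxis.Para.coarse c0f (Df / 2) Df (TwoAxis.Para.lam0 Af vα vβ yX) +
      (c0f * (Af * (modulus nL hL vα vβ * (min (σ * paLo) (σ * paHi)) -
        max (vα * ((shearUnit nL hL : ℤ) * (min (σ * pbLo) (σ * pbHi) - 1))) (vα * ((shearUnit nL hL : ℤ) * (max (σ * pbLo) (σ * pbHi)) + shearUnit nL hL - 1))) / nL)) / Df)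
    (hP1 : TwoAxis.Para.coarse c0f (Df / 2) Df (TwoAxis.Para.lam0 Af vα vβ yX) +
      (c0f * (Af * (modulus nL hL vα vβ * (max (σ * paLo) (σ * paHi)) -
        min (vα * ((shearUnit nL hL : ℤ) * (min (σ * pbLo) (σ * pbHi) - 1))) (vα * ((shearUnit nL hL : ℤ) * (max (σ * pbLo) (σ * pbHi)) + shearUnit nL hL - 1))) / nL)) / Df
        + 1 ≤ PHI 0)
    (hP2 : PLO 1 ≤ TwoAxis.Para.coarse c1f (Df / 2) Df (TwoAxis.Para.lam1 Af nL hL yX) + (c1f * (Af * ((shearUnit nL hL : ℤ) * (min (σ * pbLo) (σ * pbHi) - 1)))) / Df)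
    (hP3 : TwoAxis.Para.coarse c1f (Df / 2) Df (TwoAxis.Para.lam1 Af nL hL yX) +
      (c1f * (Af * ((shearUnit nL hL : ℤ) * (max (σ * pbLo) (σ * pbHi)) + shearUnit nL hL - 1))) / Df + 1 ≤ PHI 1)
    (hPf₁ : sgOf du = 1 → flo ≤ PLO du.1 ∧ PHI du.1 ≤ fhi) (hPf₂ : sgOf du = -1 → flo ≤ -PHI du.1 ∧ -PLO du.1 ≤ fhi)
    (hPf₃ : -fw ≤ PLO (oth du.1) ∧ PHI (oth du.1) ≤ fw)
    -- ROOM NUMBERS (c′): the y′-run's REGIONS ONE BY ONE (hp-8 g33: no prism-hull reading of a drifting run) and its last core, as boxes of the y′-frame, readings (sign `σ'`, origin `yY`)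
    {qaLo qbLo qaHi qbHi : ℕ → ℤ} (hregY : ∀ k ≤ Ny, (yRunSched hnL hvL hlay R's qY Ny).region k ⊆ Finset.Icc (pt (qbLo k) (qaLo k)) (pt (qbHi k) (qaHi k)))
    {maLo mbLo maHi mbHi : ℤ} (hlastcY : (yRunSched hnL hvL hlay R's qY Ny).core (Ny + 1) ⊆ Finset.Icc (pt mbLo maLo) (pt mbHi maHi))
    {QLO QHI : ℕ → Site 2} {LLO LHI : Site 2}
    (hQ0 : ∀ k ≤ Ny, QLO k 0 ≤ TwoAxis.Para.coarse c0f (Df / 2) Df (TwoAxis.Para.lam0 Af vα vβ yY) +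
      (c0f * (Af * (modulus nL hL vα vβ * (min (σ' * qaLo k) (σ' * qaHi k)) -
        max (vα * ((shearUnit nL hL : ℤ) * (min (σ' * qbLo k) (σ' * qbHi k) - 1))) (vα * ((shearUnit nL hL : ℤ) * (max (σ' * qbLo k) (σ' * qbHi k)) + shearUnit nL hL - 1))) / nL)) / Df)
    (hQ1 : ∀ k ≤ Ny, TwoAxis.Para.coarse c0f (Df / 2) Df (TwoAxis.Para.lam0 Af vα vβ yY) +
      (c0f * (Af * (modulus nL hL vα vβ * (max (σ' * qaLo k) (σ' * qaHi k)) -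
        min (vα * ((shearUnit nL hL : ℤ) * (min (σ' * qbLo k) (σ' * qbHi k) - 1))) (vα * ((shearUnit nL hL : ℤ) * (max (σ' * qbLo k) (σ' * qbHi k)) + shearUnit nL hL - 1))) / nL)) / Df
        + 1 ≤ QHI k 0)
    (hQ2 : ∀ k ≤ Ny, QLO k 1 ≤ TwoAxis.Para.coarse c1f (Df / 2) Df (TwoAxis.Para.lam1 Af nL hL yY) + (c1f * (Af * ((shearUnit nL hL : ℤ) * (min (σ' * qbLo k) (σ' * qbHi k) - 1)))) / Df)
    (hQ3 : ∀ k ≤ Ny, TwoAxis.Para.coarse c1f (Df / 2) Df (TwoAxis.Para.lam1 Af nL hL yY) +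
      (c1f * (Af * ((shearUnit nL hL : ℤ) * (max (σ' * qbLo k) (σ' * qbHi k)) + shearUnit nL hL - 1))) / Df + 1 ≤ QHI k 1)
    (hQf₁ : ∀ k ≤ Ny, sgOf du = 1 → flo ≤ QLO k du.1 ∧ QHI k du.1 ≤ fhi) (hQf₂ : ∀ k ≤ Ny, sgOf du = -1 → flo ≤ -QHI k du.1 ∧ -QLO k du.1 ≤ fhi)
    (hQf₃ : ∀ k ≤ Ny, -fw ≤ QLO k (oth du.1) ∧ QHI k (oth du.1) ≤ fw)
    (hL0 : LLO 0 ≤ TwoAxis.Para.coarse c0f (Df / 2) Df (TwoAxis.Para.lam0 Af vα vβ yY) +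
      (c0f * (Af * (modulus nL hL vα vβ * (min (σ' * maLo) (σ' * maHi)) -
        max (vα * ((shearUnit nL hL : ℤ) * (min (σ' * mbLo) (σ' * mbHi) - 1))) (vα * ((shearUnit nL hL : ℤ) * (max (σ' * mbLo) (σ' * mbHi)) + shearUnit nL hL - 1))) / nL)) / Df)
    (hL1 : TwoAxis.Para.coarse c0f (Df / 2) Df (TwoAxis.Para.lam0 Af vα vβ yY) +
      (c0f * (Af * (modulus nL hL vα vβ * (max (σ' * maLo) (σ' * maHi)) -
        min (vα * ((shearUnit nL hL : ℤ) * (min (σ' * mbLo) (σ' * mbHi) - 1))) (vα * ((shearUnit nL hL : ℤ) * (max (σ' * mbLo) (σ' * mbHi)) + shearUnit nL hL - 1))) / nL)) / Df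
        + 1 ≤ LHI 0)
    (hL2 : LLO 1 ≤ TwoAxis.Para.coarse c1f (Df / 2) Df (TwoAxis.Para.lam1 Af nL hL yY) + (c1f * (Af * ((shearUnit nL hL : ℤ) * (min (σ' * mbLo) (σ' * mbHi) - 1)))) / Df)
    (hL3 : TwoAxis.Para.coarse c1f (Df / 2) Df (TwoAxis.Para.lam1 Af nL hL yY) +
      (c1f * (Af * ((shearUnit nL hL : ℤ) * (max (σ' * mbLo) (σ' * mbHi)) + shearUnit nL hL - 1))) / Df + 1 ≤ LHI 1)
    (hLg₁ : sgOf du = 1 → glo ≤ LLO du.1 ∧ LHI du.1 ≤ ghi) (hLg₂ : sgOf du = -1 → glo ≤ -LHI du.1 ∧ -LLO du.1 ≤ ghi)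
    (hLg₃ : -gw ≤ LLO (oth du.1) ∧ LHI (oth du.1) ≤ gw)
    -- ROOM NUMBERS (d): the cross link (bridge core `1` read into the run's core `0`), the clearance, the reaches inside the window
    (hxa : ∀ x ∈ Finset.Icc B.core1Lo B.core1Hi, |x 0 - σ * yX 0| ≤ qX)
    (hxb : ∀ x ∈ Finset.Icc B.core1Lo B.core1Hi,
      |σ * ((nL : ℤ) * (x 1 - yX 1) - hL * (σ * x 0 - yX 0))| + shearUnit nL hL ≤ ((nL * ℓ' / shearUnit nL hL + 1 : ℕ) : ℤ) * shearUnit nL hL)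
    (hclr : (kb : ℤ) < σ * yX 0 - qX - R's - nL) (hRn : R's ≤ nL) (hclr₁ : (kb : ℤ) < B.B₀lo 0 - B.R' - B.pr)
    (hπ1 : (B.core1Lo 0).natAbs + (B.core1Lo 1).natAbs ≤ Rπ) (hπ2 : RcX + (Nx + 1) * shearUnit nL hL ≤ Rπ)
    -- ROOM NUMBERS (d′): the y′-leg — x-clearance of every y′-region (transverse bounds of `InRegion`), the cross link x-core `Nx + 1` → y′-core `0`, the reach
    (hclrY : ∀ k ≤ Ny, ∀ b : ℤ, (yPrmW nL ℓ' hL vL R's qY Ny).bLo k - R's - nL ≤ b → b ≤ (yPrmW nL ℓ' hL vL R's qY Ny).bHi k + R's + nL →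
      (kb : ℤ) < σ * σ' * b + σ * yY 0)
    (hx₂₃ : ∀ r : Site 2, pt (r 0 - σ * yX 0) ((σ * ((nL : ℤ) * (r 1 - yX 1) - hL * (σ * r 0 - yX 0))) / (shearUnit nL hL : ℤ)) ∈
        (xRunSched nL ℓ' hL R's qX Nx).core (Nx + 1) →
      pt ((σ' * ((nL : ℤ) * (r 1 - yY 1) - hL * (σ * r 0 - yY 0))) / (shearUnit nL hL : ℤ)) (σ' * (σ * r 0 - yY 0)) ∈ (yRunSched hnL hvL hlay R's qY Ny).core 0)
    (hπ3 : ∀ k ≤ Ny, RcY + (((((k + 1 : ℕ) : ℤ) * vL).natAbs +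
      (((shearUnit nL hL : ℤ) * |((k + 1 : ℕ) : ℤ) * (yPrmW nL ℓ' hL vL R's qY Ny).sLo| + |hL| * |((k + 1 : ℕ) : ℤ) * vL| + shearUnit nL hL) / nL).natAbs + 1)) ≤ Rπ)
    -- the hop: the root's own long x side half (upper half), an input valid for `P_{S.p}` with the pinned seed as SEED
    {Δ' : ℕ} {δr : ℕ → ℝ} {η : ℝ} (hδr : 0 < δr (0 + 1 + Nx + 1 + Ny))
    (hlink : 1 - δr (0 + 1 + Nx + 1 + Ny) < (bondPercolation G S.p).real
      (linkIn (↑(pgramPrismFin G φ t nL hL (3 * ℓ') Rl) : Set V) A (pgSideHalfW G φ t nL hL ℓ' Rl σ 1)))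
    -- counts and the accuracy split
    (hcount₁ : 1 / (1 - (S.p : ℝ)) ^ (Δ' * N₁) ≤ δr (0 + 1 + Nx + 1 + Ny) * ((Finset.Icc j₀₁ j₁₁).card : ℝ))
    (hcount₂ : 1 / (1 - (S.p : ℝ)) ^ (Δ' * N₂) ≤ δr (0 + 1 + Nx + 1 + Ny) * ((Finset.Icc j₀₂ j₁₂).card : ℝ))
    (hcount₃ : 1 / (1 - (S.p : ℝ)) ^ (Δ' * N₃) ≤ δr (0 + 1 + Nx + 1 + Ny) * ((Finset.Icc j₀₃ j₁₃).card : ℝ))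
    (hη : η ≤ δr (0 + 1 + Nx + 1 + Ny) / 2)
    -- THE KITS: constants of the bridge kit `Pb` and of the run kit `Pr`, short region, zone family, short pieces
    (Pb Pr : ApronPrm) {Mz Rs Kmaxb KCmaxb Kmaxr KCmaxr rsb rsr cSb cSr cU r₁ r₂ Rb : ℕ}
    (hPNb : 1 ≤ Pb.N) (hAb : Pb.A = (Mz : ℤ) + 2)
    (hd1b : Pb.W + Pb.ℓ ≤ Pb.d) (hD1b : Pb.W + Pb.ℓ + Pb.d + 2 ≤ shellD Pb) (hD2b : Pb.ℓ + Rs + Pb.d + 3 ≤ shellD Pb) (hDρb : Rs + 1 ≤ shellD Pb)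
    (hℓb : 1 ≤ Pb.ℓ) (hWb : Rs + Pb.ℓ ≤ Pb.W) (hKmaxb : shellD Pb + Pb.W ≤ Kmaxb) (hKCmaxb : shellD Pb + Mz + 1 ≤ KCmaxb)
    (hR'b : cylRadMax G φ types Pb.ℓ (Rs + KCmaxb + (Pb.W + Kmaxb)) ≤ Pb.R')
    (hwideb : ∀ j, j₀₁ ≤ j → j ≤ j₁₁ → ∀ i, (B.B₀lo - (j : Site 2)) i + 2 * tanOff Pb.ℓs Pb.M ≤ (B.B₀hi + (j : Site 2)) i)
    (hdwb : ∀ j, j₀₁ ≤ j → j ≤ j₁₁ → ∀ i, (B.B₀lo - (j : Site 2)) i + (Pb.d + 2 : ℕ) ≤ (B.B₀hi + (j : Site 2)) i)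
    (hDwb : ∀ j, j₀₁ ≤ j → j ≤ j₁₁ → ∀ i, (B.B₀lo - (j : Site 2)) i + ((shellD Pb + 1 + Pb.d + KCmaxb + Rs : ℕ) : ℤ) ≤ (B.B₀hi + (j : Site 2)) i)
    (hTb : (Pb.W : ℤ) + Kmaxb + Pb.ℓ + 1 ≤ tanOff Pb.ℓs Pb.M) (hT'b : (shellD Pb : ℤ) + KCmaxb + Rs ≤ tanOff Pb.ℓs Pb.M)
    (hr₀b : Pb.N * (tanOff Pb.ℓs Pb.M + 2) + Pb.N * Pb.d + (Pb.W + Kmaxb + Pb.R') + (KCmaxb + Rs) ≤ Pb.r₀) (hRb₀ : Pb.r₀ ≤ Rπ)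
    (hrsb : 2 * (1 + Pb.N * (tanOff Pb.ℓs Pb.M + 2) + Pb.N * Pb.d + (Pb.W + Kmaxb + Pb.R') + (KCmaxb + Rs)) ≤ rsb)
    (hcSb : (Pb.N + 1) * (tanOff Pb.ℓs Pb.M + 1) + (Pb.N + 1) * Pb.d + (2 * Pb.W + 1) * (Kmaxb + 1) * (Δg + 1) ^ Pb.R' ≤ cSb)
    (hEb : j₁₁ + (Pb.N * (tanOff Pb.ℓs Pb.M + 1) + Pb.N * Pb.d + KCmaxb) ≤ B.R')
    (hreachb : r₁ + (Pb.N * (tanOff Pb.ℓs Pb.M + 1) + Pb.N * Pb.d + KCmaxb) ≤ Pb.r₀) (hr₁ : Rb ≤ r₁) (hr₁R : r₁ ≤ Rπ)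
    (hPNr : kq + 3 ≤ Pr.N) (hAr : Pr.A = (Mz + 1 : ℕ) * (shearUnit nL hL : ℤ) + 1)
    (hd1r : Pr.W + Pr.ℓ ≤ Pr.d) (hD1r : Pr.W + Pr.ℓ + Pr.d + 2 ≤ shellD Pr) (hD2r : Pr.ℓ + Rs + Pr.d + 3 ≤ shellD Pr) (hDρr : Rs + 1 ≤ shellD Pr)
    (hℓr : 1 ≤ Pr.ℓ) (hWr : Rs + Pr.ℓ ≤ Pr.W) (hKmaxr : (shellD Pr + Pr.W) * (kq + 1) ≤ Kmaxr) (hKCmaxr : (shellD Pr + Mz + 1) * (kq + 1) ≤ KCmaxr)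
    (hR'r : cylRadMax G φ types Pr.ℓ (Rs + KCmaxr + (Pr.W + Kmaxr)) ≤ Pr.R')
    (hwider : ∀ k ≤ Nx, ∀ j, j₀₂ ≤ j → j ≤ j₁₂ → ∀ i, ((xRunSched nL ℓ' hL R's qX Nx).lo k - (j : Site 2)) i + 2 * tanOff Pr.ℓs Pr.M ≤
      ((xRunSched nL ℓ' hL R's qX Nx).hi k + (j : Site 2)) i)
    (hdwr : ∀ k ≤ Nx, ∀ j, j₀₂ ≤ j → j ≤ j₁₂ → ∀ i, ((xRunSched nL ℓ' hL R's qX Nx).lo k - (j : Site 2)) i + (Pr.d + 2 : ℕ) ≤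
      ((xRunSched nL ℓ' hL R's qX Nx).hi k + (j : Site 2)) i)
    (hDwr : ∀ k ≤ Nx, ∀ j, j₀₂ ≤ j → j ≤ j₁₂ → ∀ i, ((xRunSched nL ℓ' hL R's qX Nx).lo k - (j : Site 2)) i + ((shellD Pr + 1 + Pr.d + KCmaxr + Rs : ℕ) : ℤ) ≤
      ((xRunSched nL ℓ' hL R's qX Nx).hi k + (j : Site 2)) i)
    (hwidey : ∀ k ≤ Ny, ∀ j, j₀₃ ≤ j → j ≤ j₁₃ → ∀ i, ((yRunSched hnL hvL hlay R's qY Ny).lo k - (j : Site 2)) i + 2 * tanOff Pr.ℓs Pr.M ≤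
      ((yRunSched hnL hvL hlay R's qY Ny).hi k + (j : Site 2)) i)
    (hdwy : ∀ k ≤ Ny, ∀ j, j₀₃ ≤ j → j ≤ j₁₃ → ∀ i, ((yRunSched hnL hvL hlay R's qY Ny).lo k - (j : Site 2)) i + (Pr.d + 2 : ℕ) ≤
      ((yRunSched hnL hvL hlay R's qY Ny).hi k + (j : Site 2)) i)
    (hDwy : ∀ k ≤ Ny, ∀ j, j₀₃ ≤ j → j ≤ j₁₃ → ∀ i, ((yRunSched hnL hvL hlay R's qY Ny).lo k - (j : Site 2)) i + ((shellD Pr + 1 + Pr.d + KCmaxr + Rs : ℕ) : ℤ) ≤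
      ((yRunSched hnL hvL hlay R's qY Ny).hi k + (j : Site 2)) i)
    (hTr : (Pr.W : ℤ) + Kmaxr + Pr.ℓ + 1 ≤ tanOff Pr.ℓs Pr.M) (hT'r : (shellD Pr : ℤ) + KCmaxr + Rs ≤ tanOff Pr.ℓs Pr.M)
    (hr₀r : Pr.N * (tanOff Pr.ℓs Pr.M + 2) + Pr.N * Pr.d + (Pr.W + Kmaxr + Pr.R') + (KCmaxr + Rs) ≤ Pr.r₀) (hRr₀ : Pr.r₀ ≤ Rπ)
    (hrsr : 2 * (1 + Pr.N * (tanOff Pr.ℓs Pr.M + 2) + Pr.N * Pr.d + (Pr.W + Kmaxr + Pr.R') + (KCmaxr + Rs)) ≤ rsr)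
    (hcSr : (Pr.N + 1) * (tanOff Pr.ℓs Pr.M + 1) + (Pr.N + 1) * Pr.d + (2 * Pr.W + 1) * (Kmaxr + 1) * (Δg + 1) ^ Pr.R' ≤ cSr)
    (hEr : j₁₂ + (Pr.N * (tanOff Pr.ℓs Pr.M + 1) + Pr.N * Pr.d + KCmaxr) ≤ R's)
    (hEy : j₁₃ + (Pr.N * (tanOff Pr.ℓs Pr.M + 1) + Pr.N * Pr.d + KCmaxr) ≤ R's)
    (hreachr : r₂ + (Pr.N * (tanOff Pr.ℓs Pr.M + 1) + Pr.N * Pr.d + KCmaxr) ≤ Pr.r₀) (hr₂ : Rl ≤ r₂) (hr₂R : r₂ ≤ Rπ)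
    (QK : ShortPcO V) (hRgRs : ∀ c, QK.RS c ≤ Rs) (hRgcard : ∀ c, (RgO G φ QK c).card ≤ cU) (hcU1 : 1 ≤ cU)
    (hnSK : ∀ c, 22 * Mz + 58 ≤ QK.nS c) (hκSK : ∀ c, |QK.hS c| ≤ 10 * (QK.nS c : ℤ)) (hℓSK : ∀ c, 24 * Mz + 64 ≤ QK.ℓS c) (hκL10 : |hL| ≤ 10 * (nL : ℤ))
    (Λc : V → ℕ → Finset V) (kz : ℕ) (hkn : ∀ c, Λc c kz ⊆ Λc c Mz) (hΛ : ∀ c, ∀ v ∈ Λc c Mz, v ∈ RgO G φ QK c ∧ φ v - φ c ∈ box 2 Mz)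
    (hZ : ∀ c, (↑(Λc c Mz) : Set V) ⊆ cyl φ c Mz) (hMz : Mz < nL) (hclrz : (Mz + 4) * (nL + hL.natAbs) ≤ nL * (ℓ' + 1))
    -- the bridge stride at every centre: region, piece, readings, off the zone
    (Qb Fb : V → Finset V)
    (hQb : ∀ c, ∀ w ∈ Qb c, w ∈ graphBall G c Rb ∧
      rootFrame φ t σ w ∈ Finset.Icc (rootFrame φ t σ c - ((B.pr : ℕ) : Site 2)) (rootFrame φ t σ c + ((B.pr : ℕ) : Site 2)))
    (hFb : ∀ c, ∀ w ∈ Fb c, w ∈ Qb c ∧ rootFrame φ t σ w ∈ Finset.Icc (rootFrame φ t σ c + B.dlo) (rootFrame φ t σ c + B.dhi))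
    (hFZ : ∀ c, Disjoint (Fb c) (Λc c Mz))
    -- contact-count budgets of the two kits
    (kk₁ kk₂ kk₃ : ℕ) (hkN₁ : kk₁ * (Δg + 1) ^ (2 * rsb) ≤ N₁) (hkN₂ : kk₂ * (Δg + 1) ^ (2 * rsr) ≤ N₂) (hkN₃ : kk₃ * (Δg + 1) ^ (2 * rsr) ≤ N₃)
    (hk₁ : (1 - (S.p : ℝ) ^ (1 + Δg * cSb + cSb * cU)) ^ kk₁ ≤ δr (0 + 1 + Nx + 1 + Ny)) (hk₂ : (1 - (S.p : ℝ) ^ (1 + Δg * cSr + cSr * cU)) ^ kk₂ ≤ δr (0 + 1 + Nx + 1 + Ny))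
    (hk₃ : (1 - (S.p : ℝ) ^ (1 + Δg * cSr + cSr * cU)) ^ kk₃ ≤ δr (0 + 1 + Nx + 1 + Ny))
    -- THE STEP-I″ INPUTS AT EVERY CENTRE (all for `P_q`)
    (hzone : ∀ c, 1 - δr (0 + 1 + Nx + 1 + Ny) ^ 2 < (bondPercolation G S.p).real (UniqZone.zone G (Λc c) kz Mz))
    (hexitb : ∀ c (i : Fin 2) (σ₀ : ℤˣ), 1 - δr (0 + 1 + Nx + 1 + Ny) ^ 2 < (bondPercolation G S.p).real
      (linkIn (↑(RgO G φ QK c) : Set V) (Λc c kz) (pexRO G φ QK Mz Pb.A σ i σ₀ c)))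
    (hexitr : ∀ c (i : Fin 2) (σ₀ : ℤˣ), 1 - δr (0 + 1 + Nx + 1 + Ny) ^ 2 < (bondPercolation G S.p).real
      (linkIn (↑(RgO G φ QK c) : Set V) (Λc c kz) (pexXO G φ QK Mz nL hL Pr.A σ i σ₀ c)))
    (hexity : ∀ c (i : Fin 2) (σ₀ : ℤˣ), 1 - δr (0 + 1 + Nx + 1 + Ny) ^ 2 < (bondPercolation G S.p).real
      (linkIn (↑(RgO G φ QK c) : Set V) (Λc c kz) (pexYO G φ QK Mz nL hL Pr.A σ' i σ₀ c)))
    (hbridge : ∀ c, 1 - δr (0 + 1 + Nx + 1 + Ny) ^ 2 < (bondPercolation G S.p).real (linkIn (↑(Qb c) : Set V) (Λc c kz) (Fb c)))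
    (hlong : ∀ c (τ : ℤ), τ = 1 ∨ τ = -1 → 1 - δr (0 + 1 + Nx + 1 + Ny) ^ 2 < (bondPercolation G S.p).real
      (linkIn (pgramPrism G φ c nL hL (3 * ℓ') Rl) (Λc c kz) (pgSideHalfW G φ c nL hL ℓ' Rl σ (σ * τ))))
    (hlongy : ∀ c (τ : ℤ), τ = 1 ∨ τ = -1 → 1 - δr (0 + 1 + Nx + 1 + Ny) ^ 2 < (bondPercolation G S.p).real
      (linkIn (pgramPrism G φ c nL hL (3 * ℓ') Rl) (Λc c kz) (pgTopPieceW G φ c nL hL ℓ' Rl σ' τ vL)))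
    -- the planar diameter `mπ` (in `φ`) of the root world, and the excess radius at depth `ρ + 1` for habitats of that diameter
    -- (conclusion of `exists_excess_radius_uniform`), below both rim radii
    {mπ : ℕ} (hUm : ∀ d ∈ S.U0root du, ∀ d' ∈ S.U0root du, φ d - φ d' ∈ box 2 mπ)
    {R₁ : ℕ}
    (hR₁ : ∀ R', R₁ ≤ R' → ∀ (Rw : ℕ) (D' B' : Finset V), (∀ d ∈ D', d ∈ graphBall G t Rw) →
      (∀ d ∈ D', ∀ d' ∈ D', φ d - φ d' ∈ box 2 mπ) → B' ⊆ D' → (∀ a ∈ B', a ∈ graphBall G t (ρ + 1)) →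
        (bondPercolation G S.p).real (excess G t R' D' B') ≤ η)
    (hR₁b : R₁ ≤ Rπ - Pb.r₀) (hR₁r : R₁ ≤ Rπ - Pr.r₀) :
    RootOblTWAt G S Δ' δr du := by
  set FS := fineSkel φ t Af nL hL vα vβ c0f c1f (Df / 2) (Df / 2) Df with hFS
  set SX := xRunSched nL ℓ' hL R's qX Nx with hSX
  have hU0 : 0 < (shearUnit nL hL : ℤ) := shearUnit_pos hnL hL
  have hσabs : |σ| = 1 := by rcases hσ with h | h <;> simp [h]
  have hσsq : σ * σ = 1 := by rcases hσ with rfl | rfl <;> simp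
  obtain ⟨he0, he1⟩ := fineSkel_of_φ_eq (φ := φ) t (Af := Af) (nL := nL) (hL := hL) (vα := vα) (vβ := vβ) (c0f := c0f) (c1f := c1f) (Df := Df) hcX
  -- run coordinates at `cX` versus root-frame coordinates
  have hrun0 : ∀ w, runX φ cX nL hL σ w 0 = rootFrame φ t σ w 0 - σ * yX 0 := fun w => by
    rw [runX_zero, relCoord_apply, rootFrame_apply_zero, hcX, Pi.add_apply]; ring
  have hrun1 : ∀ w, runX φ cX nL hL σ w 1 = (σ * ((nL : ℤ) * (rootFrame φ t σ w 1 - yX 1) - hL * (σ * rootFrame φ t σ w 0 - yX 0))) / (shearUnit nL hL : ℤ) :=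
    fun w => by
    rw [runX_one, shearCoord_apply, rootFrame_apply_zero, rootFrame_apply_one, hcX, Pi.add_apply, Pi.add_apply]
    congr 1
    have : σ * (σ * (φ w 0 - φ t 0)) = φ w 0 - φ t 0 := by rw [← mul_assoc, hσsq, one_mul]
    rw [this]; ring
  -- (1) near-root footprints by the two lattice functionals (NEG-SCOPE B.17 (L-R2′)): the bridge region and the hop prism
  have hσσ : ∀ z : ℤ, σ * (σ * z) = z := fun z => by rw [← mul_assoc, hσsq, one_mul]
  have hnear : ∀ w, |vβ * (φ w 0 - φ t 0) - vα * (φ w 1 - φ t 1)| ≤ Λ₀ → |(nL : ℤ) * (φ w 1 - φ t 1) - hL * (φ w 0 - φ t 0)| ≤ Λ₁ →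
      FootBox flo fhi fw du (FS w) := fun w h0 h1 => by
    obtain ⟨k0, k1⟩ := abs_fineSkel_le_of_lam₂ (φ := φ) t hDf hc0 hc1 hkR0 hkR1 h0 h1
    have hd : du.1 = 0 ∨ du.1 = 1 := by rcases du with ⟨i, b⟩; fin_cases i <;> simp
    rcases hd with hd | hd
    · obtain ⟨f1, f2, f3⟩ := hfR0 hd
      have ho : oth du.1 = 1 := by rw [hd]; rfl
      exact footBox_of_abs_le (hd ▸ k0) (ho ▸ k1) f1 f2 f3
    · obtain ⟨f1, f2, f3⟩ := hfR1 hd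
      have ho : oth du.1 = 0 := by rw [hd]; rfl
      exact footBox_of_abs_le (hd ▸ k1) (ho ▸ k0) f1 f2 f3
  have hfoot₁ : ∀ w ∈ graphBall G t Rπ, rootFrame φ t σ w ∈ Finset.Icc B.regionLo B.regionHi → FootBox flo fhi fw du (FS w) := fun w _ hw => by
    obtain ⟨h0, h1⟩ := hΛR _ hw
    simp only [rootFrame_apply_zero, rootFrame_apply_one, hσσ] at h0 h1
    exact hnear w h0 h1
  have hQfoot : ∀ w ∈ pgramPrismFin G φ t nL hL (3 * ℓ') Rl, FootBox flo fhi fw du (FS w) := fun w hw => by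
    obtain ⟨h0, h1⟩ := lam_bounds_of_mem_pgramCyl (φ := φ) hnL hvα hmf ((mem_pgramPrismFin G φ).1 hw).2
    exact hnear w (h0.trans hΛQ0) (h1.trans hΛQ1)
  have hQπ : ∀ w ∈ pgramPrismFin G φ t nL hL (3 * ℓ') Rl, w ∈ graphBall G t Rπ := fun w hw =>
    graphBall_mono G t hRlπ (pgramPrism_subset_graphBall t nL hL (3 * ℓ') Rl ((mem_pgramPrismFin G φ).1 hw))
  -- (2) the hop's landing inside core `0` of the bridge
  have hT₀ : ∀ w ∈ pgSideHalfW G φ t nL hL ℓ' Rl σ 1, w ∈ graphBall G t Rπ ∧ rootFrame φ t σ w ∈ Finset.Icc B.B₀lo B.B₀hi := fun w hw => by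
    refine ⟨hQπ w ((mem_pgramPrismFin G φ).2 (coe_pgSideHalfW_subset (G := G) (φ := φ) t nL hL ℓ' Rl σ 1 (Finset.mem_coe.2 hw))), hB0 ?_⟩
    have hb := rootFrame_mem_box_of_sideHalf_same t hσ hnL (h := hL) (ℓ := ℓ') (R := Rl) (τ := 1) (Or.inl rfl) hw
    rw [rootFrame_self, zero_add, zero_add, one_mul, min_eq_left (by positivity : (0 : ℤ) ≤ ℓ'), max_eq_right (by positivity : (0 : ℤ) ≤ ℓ'), add_zero] at hb
    exact hb
  -- (3) the run's regions and last core
  have hreadP : ∀ w, runX φ cX nL hL σ w ∈ SX.prism → FootBox flo fhi fw du (FS w) := fun w hw => by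
    have hw' := runX_sign_mem_Icc cX hnL hL hσ (hprism hw)
    refine footBox_of_runX_mem_Icc t hAf hnL hmf hc0 hc1 hDf cX (LO := PLO) (HI := PHI) ?_ ?_ ?_ ?_ hPf₁ hPf₂ hPf₃ hw'
    · rw [he0]; simpa only [pt_zero, pt_one] using hP0
    · rw [he0]; simpa only [pt_zero, pt_one] using hP1
    · rw [he1]; simpa only [pt_zero, pt_one] using hP2
    · rw [he1]; simpa only [pt_zero, pt_one] using hP3
  have hfoot₂ : ∀ k ≤ Nx, ∀ w ∈ graphBall G t Rπ, runX φ cX nL hL σ w ∈ SX.region k → FootBox flo fhi fw du (FS w) :=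
    fun k hk w _ hw => hreadP w (SX.sub_prism k hk hw)
  -- (3′) the y′-leg's rooms
  obtain ⟨hfoot₃, hclear₃, hTne₃, hx₂₃', hlastf⟩ := legY_roomsR (φ := φ) hstep hσ hσ' (Rπ := Rπ) du hAf hnL hL hmf hc0 hc1 hDf R's cX hcX qX Nx hvL hlay qY Ny cY hcY hcYπ
    (kb := kb) hregY hlastcY hQ0 hQ1 hQ2 hQ3 hQf₁ hQf₂ hQf₃ hL0 hL1 hL2 hL3 hLg₁ hLg₂ hLg₃ hclrY hx₂₃ hπ3
  -- (4) clearances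
  have hAk : ∀ a ∈ A, |rootFrame φ t σ a 0| ≤ kb := fun a ha => by
    rw [rootFrame_apply_zero, abs_mul, hσabs, one_mul]; exact hAφ a ha
  have hclear₂ : ∀ k ≤ Nx, ∀ w ∈ graphBall G t Rπ, runX φ cX nL hL σ w ∈ SX.region k → (kb : ℤ) < rootFrame φ t σ w 0 := by
    intro k hk w _ hw
    rw [hSX, xRunSched, mem_scheduleN_region_iff (xPrmW_ok nL ℓ' hL R's qX Nx) (xPrmW_eb nL ℓ' hL R's qX Nx)] at hw
    obtain ⟨h0, -, -, -⟩ := hw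
    simp only [RunPrm.aLo, xPrmW] at h0
    rw [hrun0] at h0
    have hkR : (k : ℤ) * (R's : ℤ) ≤ (k : ℤ) * (nL : ℤ) := mul_le_mul_of_nonneg_left (by exact_mod_cast hRn) (by positivity)
    linarith
  -- (5) the cross link
  have hx : ∀ w ∈ graphBall G t Rπ, rootFrame φ t σ w ∈ Finset.Icc B.core1Lo B.core1Hi → runX φ cX nL hL σ w ∈ SX.core 0 := by
    intro w _ hw
    rw [hSX, xRunSched, mem_scheduleN_core_iff (xPrmW_ok nL ℓ' hL R's qX Nx) (xPrmW_eb nL ℓ' hL R's qX Nx), RunPrm.inCore_zero_iff, hrun0, hrun1]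
    have ha := abs_le.1 (hxa _ hw)
    have hb := hxb _ hw
    set sv := σ * ((nL : ℤ) * (rootFrame φ t σ w 1 - yX 1) - hL * (σ * rootFrame φ t σ w 0 - yX 0)) with hsv
    have hW : (((nL * ℓ' / shearUnit nL hL + 1 : ℕ) : ℤ)) = ((xPrmW nL ℓ' hL R's qX Nx).Wm : ℤ) := by simp [xPrmW]
    have hW' : (((nL * ℓ' / shearUnit nL hL + 1 : ℕ) : ℤ)) = ((xPrmW nL ℓ' hL R's qX Nx).Wp : ℤ) := by simp [xPrmW]
    have hq : ((xPrmW nL ℓ' hL R's qX Nx).q : ℤ) = qX := by simp [xPrmW]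
    rw [hq, ← hW, ← hW']
    have hsv' := abs_le.1 (show |sv| ≤ ((nL * ℓ' / shearUnit nL hL + 1 : ℕ) : ℤ) * shearUnit nL hL - shearUnit nL hL by linarith)
    refine ⟨ha.1, ha.2, ?_, ?_⟩
    · rw [Int.le_ediv_iff_mul_le hU0]
      linarith [hsv'.1]
    · have hlt : sv / (shearUnit nL hL : ℤ) < ((nL * ℓ' / shearUnit nL hL + 1 : ℕ) : ℤ) + 1 := by
        rw [Int.ediv_lt_iff_lt_mul hU0]; linarith [hsv'.2]
      omega
  -- (6) nonempty targets
  have hTne₁ : (Win G (rootFrame φ t σ) t (Finset.Icc B.core1Lo B.core1Hi) Rπ).Nonempty := by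
    obtain ⟨g, hg, hφg⟩ := exists_mem_graphBall_φ_eq hstep t (φ t + pt (σ * B.core1Lo 0) (B.core1Lo 1))
    refine ⟨g, (mem_Win G _).2 ⟨graphBall_mono G t ?_ hg, ?_⟩⟩
    · simp only [Pi.add_apply, pt_zero, pt_one, add_sub_cancel_left]
      rw [Int.natAbs_mul, show σ.natAbs = 1 by rcases hσ with h | h <;> simp [h], one_mul]
      exact hπ1
    · have h0 : rootFrame φ t σ g 0 = B.core1Lo 0 := by
        rw [rootFrame_apply_zero, hφg, Pi.add_apply, pt_zero]; rw [show φ t 0 + σ * B.core1Lo 0 - φ t 0 = σ * B.core1Lo 0 by ring, ← mul_assoc, hσsq, one_mul]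
      have h1 : rootFrame φ t σ g 1 = B.core1Lo 1 := by
        rw [rootFrame_apply_one, hφg, Pi.add_apply, pt_one]; ring
      have hg' : rootFrame φ t σ g = B.core1Lo := by funext i; fin_cases i <;> assumption
      rw [hg']
      exact Finset.mem_Icc.2 ⟨le_rfl, BridgePrm.core1Lo_le_core1Hi hB⟩
  have hTne₂ : ∀ k ≤ Nx, (Win G (runX φ cX nL hL σ) t (SX.core (k + 1)) Rπ).Nonempty := by
    intro k hk
    obtain ⟨g, hg, hφg⟩ := exists_mem_graphBall_φ_eq hstep cX (φ cX + pt (σ * (((k + 1 : ℕ) : ℤ) * nL)) (σ * (((k + 1 : ℕ) : ℤ) * hL)))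
    refine ⟨g, (mem_Win G _).2 ⟨?_, ?_⟩⟩
    · -- window position: `dist(t, g) ≤ RcX + (k+1)·U ≤ Rπ`
      have hg' : g ∈ graphBall G cX ((k + 1) * shearUnit nL hL) := by
        refine graphBall_mono G cX (le_of_eq ?_) hg
        simp only [Pi.add_apply, pt_zero, pt_one, add_sub_cancel_left, Int.natAbs_mul, show σ.natAbs = 1 by rcases hσ with h | h <;> simp [h], one_mul,
          Int.natAbs_natCast]
        unfold shearUnit; ring
      have h := BoxProdZ2.mem_graphBall_add G hcXπ hg'
      refine graphBall_mono G t ?_ h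
      have : (k + 1) * shearUnit nL hL ≤ (Nx + 1) * shearUnit nL hL := Nat.mul_le_mul_right _ (by omega)
      omega
    · rw [hSX, xRunSched, mem_scheduleN_core_iff (xPrmW_ok nL ℓ' hL R's qX Nx) (xPrmW_eb nL ℓ' hL R's qX Nx)]
      have h0 : runX φ cX nL hL σ g 0 = ((k + 1 : ℕ) : ℤ) * nL := by
        rw [runX_zero, relCoord_apply, hφg, Pi.add_apply, pt_zero]
        rw [show φ cX 0 + σ * (((k + 1 : ℕ) : ℤ) * ↑nL) - φ cX 0 = σ * (((k + 1 : ℕ) : ℤ) * ↑nL) by ring, ← mul_assoc, hσsq, one_mul]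
      have h1 : runX φ cX nL hL σ g 1 = 0 := by
        rw [runX_one, shearCoord_apply, hφg, Pi.add_apply, Pi.add_apply, pt_zero, pt_one]
        rw [show σ * (↑nL * (φ cX 1 + σ * (((k + 1 : ℕ) : ℤ) * hL) - φ cX 1) - hL * (φ cX 0 + σ * (((k + 1 : ℕ) : ℤ) * ↑nL) - φ cX 0)) = 0 by ring]
        simp
      rw [h0, h1]
      have hnom := RunPrm.inCore_nominal (xPrmW_ok nL ℓ' hL R's qX Nx) (k + 1)
      have hs : ((xPrmW nL ℓ' hL R's qX Nx).sLo : ℤ) = nL := rfl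
      have hd : ((xPrmW nL ℓ' hL R's qX Nx).d : ℤ) = 0 := rfl
      rw [hs, hd, mul_zero] at hnom
      exact hnom
  -- assemble
  exact rootOblTWAt_of_inputsG5_y hlipφ hstep hfr hκ hΔg S hroot du hσ (fun w => FootBox flo fhi fw du (FS w))
    (fun w => FootBox glo ghi gw du (FS w)) hUfoot hMfoot htA hAconn hAρ hρπ hAQ hAk B hB hnL cX hL hκL ℓ' R's qX Nx Rl hvL hlay cY hσ' qY Ny
    Rlev₁ N₁ j₀₁ j₁₁ Rlev₂ N₂ j₀₂ j₁₂ Rlev₃ N₃ j₀₃ j₁₃ hRl₁ hRl₂ hRl₃ hj₁ hj₂ hj₃ hfoot₁ hfoot₂ hfoot₃ hclr₁ hclear₂ hclear₃ hTne₁ hTne₂ hTne₃ hx hx₂₃' hlastf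
    hδr hlink hQπ hQfoot hT₀ hcount₁ hcount₂ hcount₃ hη Pb Pr hPNb hAb hd1b hD1b hD2b hDρb
    hℓb hWb hKmaxb hKCmaxb hR'b hwideb hdwb hDwb hTb hT'b hr₀b hRb₀ hrsb hcSb hEb hreachb hr₁ hr₁R hPNr hAr hd1r hD1r hD2r hDρr hℓr hWr hKmaxr hKCmaxr hR'r
    hwider hdwr hDwr hwidey hdwy hDwy hTr hT'r hr₀r hRr₀ hrsr hcSr hEr hEy hreachr hr₂ hr₂R QK hRgRs hRgcard hcU1 hnSK hκSK hℓSK hκL10 Λc kz hkn hΛ hZ hMz hclrz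
    Qb Fb hQb hFb hFZ kk₁ kk₂ kk₃ hkN₁ hkN₂ hkN₃ hk₁ hk₂ hk₃ hzone hexitb hexitr hexity hbridge hlong hlongy hUm hR₁ hR₁b hR₁r

end Skelφ

end Transplant

end Summit.CriticalPhenomena.PercolationContinuityZ3.Theorems

end
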